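import Summits.Schanuel.Schanuel.Theses.BenfordTowers
import Literature.NumberTheory.DiophantineApproximation.KroneckerTheorem

/-!
BC5 special case (crux strategist, stmt-Schanuel-11400): the ONE-PRIME case `r = 1` of piece 1
`HomPrimeLogSector`, with NO sorry — a non-zero homogeneous polynomial of degree `d` in one variable
is `c·X^d` with `c ≠ 0`, and `c·(log ℓ)^d ≠ 0` because `log ℓ ≠ 0` for a prime `ℓ`.  Shows the
definitions compute and the piece is inhabited in kind.
-/

open Summit.Schanuel.Schanuel.Theses.BenfordTowers MvPolynomial

theorem homPrimeLogSector_one_prime :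
    ∀ (ℓ : Fin 1 → ℕ), (∀ i, (ℓ i).Prime) → Function.Injective ℓ →
      ∀ (d : ℕ) (P : MvPolynomial (Fin 1) ℚ), P.IsHomogeneous d → P ≠ 0 →
        MvPolynomial.aeval (fun i => Real.log (ℓ i)) P ≠ 0 := by
  intro ℓ hℓ _ d P hhom hP
  have hx : Real.log (ℓ 0) ≠ 0 :=
    (Real.log_pos (by exact_mod_cast (hℓ 0).one_lt)).ne'
  -- every monomial in the support is `single 0 d`
  have hsupp : ∀ m ∈ P.support, m = Finsupp.single 0 d := by
    intro m hm
    have h := hhom (mem_support_iff.mp hm)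
    rw [Finsupp.weight_apply, Finsupp.sum_fintype _ _ (fun _ => by simp)] at h
    simp only [Pi.one_apply, smul_eq_mul, mul_one, Fin.sum_univ_one] at h
    exact Finsupp.ext fun i => by rw [Subsingleton.elim i 0, Finsupp.single_eq_same]; exact h
  -- hence `P` is the single monomial `c • X^d`
  have hc : coeff (Finsupp.single 0 d) P ≠ 0 := by
    intro hc
    apply hP
    ext m
    by_cases hm : m ∈ P.support
    · rw [hsupp m hm, hc, coeff_zero]
    · simpa [mem_support_iff] using hm
  have hPeq : P = monomial (Finsupp.single 0 d) (coeff (Finsupp.single 0 d) P) := by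
    ext m
    rw [coeff_monomial]
    by_cases hm : Finsupp.single 0 d = m
    · rw [if_pos hm, hm]
    · rw [if_neg hm]
      by_contra hne
      exact hm (hsupp m (mem_support_iff.mpr hne)).symm
  have hprod : (Finsupp.single (0 : Fin 1) d).prod (fun i k => Real.log (ℓ i) ^ k)
      = Real.log (ℓ 0) ^ d :=
    Finsupp.prod_single_index (by simp)
  rw [hPeq, aeval_monomial, hprod]
  exact mul_ne_zero ((map_ne_zero_iff _ (algebraMap ℚ ℝ).injective).mpr hc) (pow_ne_zero _ hx)

/-- BC5 special case, DEGREE `d = 1` of piece 1 `HomPrimeLogSector` for every number of primes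
(= "Baker's degree 1", here plain unique factorisation): a non-zero LINEAR form over `ℚ` does not
vanish at the logarithms of distinct primes.  No sorry. -/
theorem homPrimeLogSector_degree_one :
    ∀ (r : ℕ) (ℓ : Fin r → ℕ), (∀ i, (ℓ i).Prime) → Function.Injective ℓ →
      ∀ (P : MvPolynomial (Fin r) ℚ), P.IsHomogeneous 1 → P ≠ 0 →
        MvPolynomial.aeval (fun i => Real.log (ℓ i)) P ≠ 0 := by
  intro r ℓ hℓ hinj P hhom hP hzero
  classical
  -- (1) every monomial in the support is `single i 1`
  have hsupp : ∀ m ∈ P.support, ∃ i, m = Finsupp.single i 1 := by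
    intro m hm
    have h := hhom (mem_support_iff.mp hm)
    rw [Finsupp.weight_apply, Finsupp.sum] at h
    simp only [Pi.one_apply, smul_eq_mul, mul_one] at h
    -- the support of `m` is a singleton
    have hcard : m.support.card ≤ 1 := by
      calc m.support.card = ∑ i ∈ m.support, 1 := by simp
        _ ≤ ∑ i ∈ m.support, m i := Finset.sum_le_sum fun i hi =>
            Nat.one_le_iff_ne_zero.mpr (Finsupp.mem_support_iff.mp hi)
        _ = 1 := h
    have hne : m.support.Nonempty := by
      rw [Finset.nonempty_iff_ne_empty, Ne, Finsupp.support_eq_empty]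
      rintro rfl
      simp at h
    obtain ⟨i, hi⟩ := Finset.card_eq_one.mp (le_antisymm hcard hne.card_pos)
    refine ⟨i, Finsupp.eq_single_iff.mpr ⟨hi.le, ?_⟩⟩
    have := h
    rw [hi, Finset.sum_singleton] at this
    exact this
  -- (2) the linear form: `P = ∑ i, c i • X i`
  set c : Fin r → ℚ := fun i => coeff (Finsupp.single i 1) P with hc
  have hPeq : P = ∑ i, C (c i) * X i := by
    ext m
    rw [coeff_sum]
    simp only [coeff_C_mul, coeff_X]
    by_cases hm : ∃ i, Finsupp.single i 1 = m
    · obtain ⟨i, rfl⟩ := hm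
      rw [Finset.sum_eq_single i]
      · simp [hc]
      · intro j _ hji
        rw [if_neg]
        · simp
        · exact fun h => hji ((Finsupp.single_left_inj one_ne_zero).mp h)
      · simp
    · have h0 : coeff m P = 0 := by
        by_contra hne
        obtain ⟨i, rfl⟩ := hsupp m (mem_support_iff.mpr hne)
        exact hm ⟨i, rfl⟩
      rw [h0]
      symm
      refine Finset.sum_eq_zero fun j _ => ?_
      rw [if_neg (fun h => hm ⟨j, h⟩), mul_zero]
  -- (3) the relation `∑ c i · log ℓ i = 0`
  have hrel : ∑ i, (c i : ℝ) * Real.log (ℓ i) = 0 := by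
    have := hzero
    rw [hPeq, map_sum] at this
    simpa [aeval_C, aeval_X] using this
  -- (4) linear independence of the `log ℓ i` over `ℚ` (unique factorisation, tree lemma over `ℤ`)
  set s : Finset ℕ := Finset.univ.image ℓ with hs
  have hsprime : ∀ p ∈ s, p.Prime := by
    intro p hp
    obtain ⟨i, _, rfl⟩ := Finset.mem_image.mp hp
    exact hℓ i
  have hliZ := Literature.NumberTheory.DiophantineApproximation.Kronecker.linearIndependent_log_of_prime
    s hsprime
  let f : Fin r → s := fun i => ⟨ℓ i, Finset.mem_image_of_mem ℓ (Finset.mem_univ i)⟩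
  have hf : Function.Injective f := fun i j hij => hinj (congrArg Subtype.val hij)
  have hliZ' : LinearIndependent ℤ (fun i : Fin r => Real.log (ℓ i)) := hliZ.comp f hf
  have hliQ : LinearIndependent ℚ (fun i : Fin r => Real.log (ℓ i)) :=
    (LinearIndependent.iff_fractionRing ℤ ℚ).mp hliZ'
  have hc0 : ∀ i, c i = 0 := by
    refine Fintype.linearIndependent_iff.mp hliQ c ?_
    simpa [Rat.smul_def] using hrel
  -- (5) hence `P = 0`
  apply hP
  rw [hPeq]
  simp [hc0]
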